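import Mathlib

/-!
# `Balaban1983to89.B16Ineq179` — T. Bałaban, *Large field renormalization. II. Localization, exponentiation, and
bounds for the 𝐑 operation*, Commun. Math. Phys. **122**, 355–392 (1989) [Balaban1989LargeFieldII] (cell paper B16;
PDF held `paper:balaban1989-cmp122-large-field-ii`, journal page = PDF page + 354): the summarising inequality **(1.79)**
of §1 (p. 383) and the three integration ∕ resummation sentences of p. 383 l. 21–28 that precede it, AS QUOTED LEAVES
(mega-formalization `lit-balaban` ∕ cell `pub-balaban`; filed on the NE7b row owner's INTERFACE REQUEST NE7b IR-62-1,
ruling R-OWNER-62-1, memo `HOME/t4/b2b-balaban-t4-ne7b-p1/g62/A1-PRINT-READ.md` §1 ∕ §4, whose elaboration sketch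
`g62/Ineq179Sketch.NOT-TO-FILE.b73e594ef4c7cc27.lean` this module re-homes; sibling of `…B16Sect1Kernels`, whose §3 ∕ §6
type (1.76)–(1.78) and the exponent proviso of the same page).

statement-level skeleton of published theorems with citation tags; proofs where landed; nothing here is a claim about the Yang–Mills mass gap

CITATION HEADER (lean-in-tree rule 2026-08-18).  Passages served: the page RENDERS of the cell folder
`HOME/b2b-balaban-ref1/pages/1989-cmp122-large-field-II/1989-cmp122-large-field-II-p029-x2.png` (= p. 383) and
`…-p030-x2.png` (= p. 384), READ AS IMAGES by the typist (unit `b2b-balaban-t4-ne7b-formalise-leaf-01` gen 49) and,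
independently, by the requesting owner (memo §1); the OCR text (`lit read …`) garbles the display and was NOT used for it.
WHAT IS REPRODUCED, VERBATIM (p. 383, render p029, last display; the sentence runs on to p. 384 l. 1, render p030):
*"Let us summarize now the results of the above estimates. We have obtained the following inequality:*
  𝐓′_k(X)1 ≤ sup exp{ Σ_{j=1}^{k} O(1) M^d R_j^{d+1} d′_j(Z_j) }
      · Π_{j=1}^{k} Π_i exp(−½ γ₀ A₁² p₀²(g_j) (d′_j(Z_j^{(i)}) + 1) − 2 p₀(g_j)) Π′ exp(−p₀(g_j)),      (1.79)
*where the last product is over components of Z_j satisfying the conditions (i), (ii), for which some large fields are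
created during the preparatory steps. The supremum is taken over all admissible domains, satisfying all the conditions
described in the previous sections, in particular the conditions (1.76). Notice that the above inequality holds for all
large field regions, not only for the regions satisfying the conditions (i), (ii)."*  And the paragraph before it
(p. 383 l. 21–28, render p029): *"All the integrals with respect to the group valued variables in the definition (1.71)
are estimated by 1. Similar to the integral with respect to B, we have to include only the constant with the logarithms
in the last line into the integration measure, and we estimate the quadratic form in B from below by 0. The integrals with
respect to the fields A_j in (2.21) [III], or (1.25) [IV], are estimated using the positivity properties of the
quadratic forms, and we get the factors exp O(1)|Z_j ∩ Ω_j|, where the volume is for the corresponding scale. Finally,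
the summations over the admissible sequences can be replaced by the factors exp O(1)(MR_j)^{−d}|Z_j|."*
The paper is a manuscript UNDER ADJUDICATION by the audit cell `pub-balaban`: NOTHING printed in it is asserted here.
Every declaration below is either a `Prop`-valued QUOTED LEAF over ABSTRACT carriers (a predicate with parameters — a
hypothesis SHAPE that a consumer may assume or instantiate, never a fact), a real-valued abbreviation of the display's
right-hand side, or an elementary [folklore] lemma about finite suprema; zero `sorry`, no axiom beyond Mathlib's.

WHAT IS TYPED.  §1 `rhs179` = the right-hand side of (1.79) as a real function of one admissible history `h`, in the
letters of the display: `C` = the O(1), `M`, `d`, `R j` = R_j, `dZ h j` = d′_j(Z_j), `comps h j` ∕ `dC h j i` = the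
components Z_j^{(i)} and their sizes d′_j(Z_j^{(i)}) (p. 380 last lines, render p026: the Z_j^{(i)} are the components of
the MR_j-cube cover of the step-j large field region P_j ∪ Q_j ∪ R_j — the components entering Z_j's covering
(1.76) «Z_j ⊂ Z′^{∼10}_{j−1} ∪ ⋃_i (Z_j^{(i)})^{∼2}», p. 381, render p027 —, NOT «the components of Z_j»), `p0 j` = p₀(g_j), `γ₀`, `A₁`, `primed h j` = the components
of Z_j *"satisfying the conditions (i), (ii), for which some large fields are created during the preparatory steps"*
(the range of Π′); `Ineq179` = the display with its two quantifier readings made explicit — «sup … over all admissible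
domains» is read as «the bound holds with the right-hand side evaluated at SOME member of the finite admissible family
`adm X`» (the family is finite, so the supremum is attained: `ineq179_iff_sup` proves this reading EQUIVALENT to the
`Finset.sup'` spelling `Ineq179Sup` under non-emptiness), and *"holds for all large field regions"* is the quantifier
`∀ X` over the whole domain type; `T1 X v` = 𝐓′_k(X)1 = 𝐓′_k(X,(U,0))1 at the background `v`.  §2 `Txt383` = the three
sentences of p. 383 l. 21–28 as ONE `Prop`-valued structure with three fields over the same carriers (`gInt h j` = the
group-valued integrals of (1.71) at step j, `aInt h j` = the A_j-integrals, `volZΩ h j` = |Z_j ∩ Ω_j|, `volZ h j` =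
|Z_j|, `C'`, `C''` = the two O(1)'s); the third sentence («the summations over the admissible sequences can be REPLACED
BY the factors exp O(1)(MR_j)^{−d}|Z_j|») is typed PER SEQUENCE, as print says it: a sum of non-negative weights over the
finite admissible family is at most the weight of SOME member times that member's factors (`admissible_le`; the crew's
pre-read S-1 — a total-count-uniform-in-h spelling would be STRONGER than print and is not used); its PROVED fibrewise
weighted form lives in the sibling `…B16Cor3Ops` (`sum_major_le_exp_fiber`, `fiber_le_of_card`, `count_absorb`,
[cite p. 383 before (1.79)]) and is only POINTED TO here.

WHAT IS NOT CLAIMED.  (a) That any operation 𝐓′_k of [Balaban1989LargeFieldII] satisfies `Ineq179`, or that the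
integrals of (1.71) satisfy `Txt383` — these are the paper's claims, typed as Props; (b) the identification of the
abstract carriers (`Dom`, `H`, `ι`, `V`, `adm`, …) with the objects of (1.71) — that is the consumer's junction (cell
NEEDS-COORDINATOR NC-NE7b-α, item (A1c)); (c) the optional bookkeeping corollary «per-step factors × `Txt383` ⇒
`Ineq179`» (IR-62-1's `ineq179_of_factors`) — not typed here; (d) anything about (1.80)–(1.89), which the siblings `Step`,
`B16Lem384Induction`, `B16Improved189` type.  Cell records: journal R-OWNER-62-1 (2026-08-22 l.41241), refuter
PRICING-NE7b v37 S-ref-g37-1 (the locus of §2), `lit-balaban-r13/ROWS-B16.md` row B16.Eq1.79.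
-/

namespace Literature.MathematicalPhysics.QuantumFieldTheory.Balaban1983to89.B16Ineq179

noncomputable section

/-! ## §1. (1.79) p. 383 as a quoted leaf -/

/-- THE RIGHT-HAND SIDE OF **(1.79)** p. 383 (render p029), evaluated at one admissible history `h`:
exp{ Σ_{j=1}^{k} O(1) M^d R_j^{d+1} d′_j(Z_j) } · Π_{j=1}^{k} [ Π_i exp(−½γ₀A₁²p₀²(g_j)(d′_j(Z_j^{(i)}) + 1) − 2p₀(g_j))
· Π′ exp(−p₀(g_j)) ] — `C` = the O(1), `dZ h j` = d′_j(Z_j), `comps h j` ∕ `dC h j i` = the components Z_j^{(i)} (of the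
MR_j-cube cover of the step-j large field region, p. 380) and their sizes, `primed h j` = the range of Π′ (*"components of Z_j satisfying the conditions (i), (ii), for which some
large fields are created during the preparatory steps"*), `R j` = R_j, `p0 j` = p₀(g_j).  The first exponential's `C` is the O(1) of which p. 384 l. 14–17 says *"the
expression in the first exponential in (1.79) has a universal character, it can be written for an arbitrary sequence of
domains, in particular for the sequence arising by applying the operation S"* — its sum along Z, S(Z), S²(Z), … is the
right-hand side of the control inequality (1.80) (typed in the siblings `Step` ∕ `B16Lem384Induction`).  An abbreviation,
not a claim. [cite: Balaban1989LargeFieldII, (1.79) p.383] -/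
def rhs179 {H ι : Type*} (k : ℕ) (dZ : H → ℕ → ℝ) (comps primed : H → ℕ → Finset ι) (dC : H → ℕ → ι → ℝ)
    (C M γ₀ A₁ : ℝ) (d : ℕ) (R p0 : ℕ → ℝ) (h : H) : ℝ :=
  Real.exp (∑ j ∈ Finset.Icc 1 k, C * M ^ d * R j ^ (d + 1) * dZ h j) *
    ∏ j ∈ Finset.Icc 1 k,
      ((∏ i ∈ comps h j, Real.exp (-(1 / 2) * γ₀ * A₁ ^ 2 * p0 j ^ 2 * (dC h j i + 1) - 2 * p0 j)) *
        ∏ _i ∈ primed h j, Real.exp (-(p0 j)))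

/-- **(1.79)** p. 383 [29], verbatim (render p029; last sentence continued on p. 384 l. 1, render p030): *"Let us
summarize now the results of the above estimates. We have obtained the following inequality: 𝐓′_k(X)1 ≤ sup exp{Σ_{j=1}^{k}
O(1)M^dR_j^{d+1}d′_j(Z_j)} · Π_{j=1}^{k}Π_i exp(−½γ₀A₁²p₀²(g_j)(d′_j(Z_j^{(i)}) + 1) − 2p₀(g_j)) Π′exp(−p₀(g_j)), (1.79)
where the last product is over components of Z_j satisfying the conditions (i), (ii), for which some large fields are
created during the preparatory steps. The supremum is taken over all admissible domains, satisfying all the conditions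
described in the previous sections, in particular the conditions (1.76). Notice that the above inequality holds for all
large field regions, not only for the regions satisfying the conditions (i), (ii)."* — QUANTIFIER READINGS: «sup over
all admissible domains» = the bound with the right-hand side at SOME member `h` of the finite admissible family `adm X`
(equivalent to the `Finset.sup'` spelling, `ineq179_iff_sup`); «holds for all large field regions» = `∀ X` over the whole
domain type `Dom`; `T1 X v` = 𝐓′_k(X)1 (= 𝐓′_k(X,(U,0))1 of (1.71)–(1.72)) at the background `v`.  Two remarks for
consumers (reading points of the crew's pre-read, zero weight): the ∃-spelling PRESUPPOSES `(adm X).Nonempty` at every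
`X` (a hidden conjunct — `Ineq179Sup` displays it as `hadm`); and `comps h j` ∕ `primed h j` are typed INDEPENDENTLY,
as print has them: Π_i ranges over the components Z_j^{(i)} of the MR_j-cube cover of the step-j large field region
P_j ∪ Q_j ∪ R_j (p. 380, render p026; they enter Z_j's covering (1.76) «Z_j ⊂ Z′^{∼10}_{j−1} ∪ ⋃_i (Z_j^{(i)})^{∼2}»,
p. 381, render p027), Π′ over the components of Z_j satisfying
(i), (ii) in which a preparatory large-field function is introduced (p. 381 ¶ 2, p. 383) — two different families,
neither a subfamily of the other.  A `Prop` over abstract carriers: nothing asserted.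
[cite: Balaban1989LargeFieldII, (1.79) p.383] -/
def Ineq179 {Dom H ι V : Type*} (adm : Dom → Finset H) (T1 : Dom → V → ℝ) (k : ℕ) (dZ : H → ℕ → ℝ)
    (comps primed : H → ℕ → Finset ι) (dC : H → ℕ → ι → ℝ) (C M γ₀ A₁ : ℝ) (d : ℕ) (R p0 : ℕ → ℝ) : Prop :=
  ∀ X v, ∃ h ∈ adm X, T1 X v ≤ rhs179 k dZ comps primed dC C M γ₀ A₁ d R p0 h

/-- **(1.79)** p. 383, THE `sup'` SPELLING of the same display: *"The supremum is taken over all admissible domains"* —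
`T1 X v ≤ (adm X).sup' _ (rhs179 …)` for a finite NON-EMPTY admissible family `adm X` (non-emptiness `hadm` displayed).
Equivalent to `Ineq179` (`ineq179_iff_sup`). [cite: Balaban1989LargeFieldII, (1.79) p.383] -/
def Ineq179Sup {Dom H ι V : Type*} (adm : Dom → Finset H) (hadm : ∀ X, (adm X).Nonempty) (T1 : Dom → V → ℝ)
    (k : ℕ) (dZ : H → ℕ → ℝ) (comps primed : H → ℕ → Finset ι) (dC : H → ℕ → ι → ℝ) (C M γ₀ A₁ : ℝ) (d : ℕ)
    (R p0 : ℕ → ℝ) : Prop :=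
  ∀ X v, T1 X v ≤ (adm X).sup' (hadm X) (rhs179 k dZ comps primed dC C M γ₀ A₁ d R p0)

/-- THE TWO SPELLINGS OF (1.79) AGREE: over a finite non-empty admissible family the supremum is attained
(`Finset.exists_mem_eq_sup'`), so «≤ sup» and «≤ the value at some member» are the same statement — our proof that
the two readings of the printed sentence *"The supremum is taken over all admissible domains"* coincide.
[cite: Balaban1989LargeFieldII, (1.79) p.383 («The supremum is taken over all admissible domains»)] -/
theorem ineq179_iff_sup {Dom H ι V : Type*} (adm : Dom → Finset H) (hadm : ∀ X, (adm X).Nonempty)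
    (T1 : Dom → V → ℝ) (k : ℕ) (dZ : H → ℕ → ℝ) (comps primed : H → ℕ → Finset ι) (dC : H → ℕ → ι → ℝ)
    (C M γ₀ A₁ : ℝ) (d : ℕ) (R p0 : ℕ → ℝ) :
    Ineq179 adm T1 k dZ comps primed dC C M γ₀ A₁ d R p0 ↔
      Ineq179Sup adm hadm T1 k dZ comps primed dC C M γ₀ A₁ d R p0 := by
  unfold Ineq179 Ineq179Sup
  constructor
  · intro h X v
    obtain ⟨hh, hmem, hle⟩ := h X v
    exact hle.trans (Finset.le_sup' (rhs179 k dZ comps primed dC C M γ₀ A₁ d R p0) hmem)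
  · intro h X v
    obtain ⟨hh, hmem, heq⟩ :=
      Finset.exists_mem_eq_sup' (hadm X) (rhs179 k dZ comps primed dC C M γ₀ A₁ d R p0)
    exact ⟨hh, hmem, (h X v).trans (le_of_eq heq)⟩

/-- SANITY (non-vacuity of the SHAPE, not an instance of the paper's claim): one domain, one admissible history, `k = 0`,
`𝐓′1 ≡ 1` satisfies `Ineq179` (empty sum and products: right-hand side `= 1`). [folklore] -/
example : Ineq179 (Dom := Unit) (H := Unit) (ι := Unit) (V := Unit) (fun _ => {()}) (fun _ _ => 1) 0
    (fun _ _ => 0) (fun _ _ => ∅) (fun _ _ => ∅) (fun _ _ _ => 0) 1 1 1 1 4 (fun _ => 1) (fun _ => 1) := by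
  intro X v
  refine ⟨(), by simp, ?_⟩
  simp [rhs179]

/-! ## §2. p. 383 l. 21–28: the three integration ∕ resummation sentences as one quoted leaf -/

/-- **p. 383 l. 21–28** [29], verbatim (render p029), THREE SENTENCES as the three fields of one `Prop`: *"All the
integrals with respect to the group valued variables in the definition (1.71) are estimated by 1."* (`group_le_one`:
`gInt h j ≤ 1`); *"The integrals with respect to the fields A_j in (2.21) [III], or (1.25) [IV], are estimated using the
positivity properties of the quadratic forms, and we get the factors exp O(1)|Z_j ∩ Ω_j|, where the volume is for the
corresponding scale."* (`afield_le`: `aInt h j ≤ exp (C' · volZΩ h j)`, `volZΩ h j` = |Z_j ∩ Ω_j|, `C'` = the O(1));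
*"Finally, the summations over the admissible sequences can be replaced by the factors exp O(1)(MR_j)^{−d}|Z_j|."*
(`admissible_le`, PER SEQUENCE as printed: for every non-negative weight `F` on the finite non-empty admissible family
`adm X`, `Σ_{h ∈ adm X} F h ≤ F h₀ · Π_{j=1}^{k} exp (C'' · (M R_j)^{−d} · volZ h₀ j)` for SOME member `h₀` — the sum
REPLACED BY the factors at one sequence; `volZ h j` = |Z_j|, `C''` = the O(1) — existential in print, a parameter
here.  Quantified over ALL non-negative `F` this is EQUIVALENT to the Kraft-type inequality
Σ_{h ∈ adm X} Π_{j=1}^{k} exp(−C'' (M R_j)^{−d} |Z_j(h)|) ≤ 1 (take `F` = that weight; conversely bound each term by its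
maximum), so it PRESUPPOSES that every member of `adm X` carries large-field volume at some step — as print's admissible
sequences of a LARGE field region do (*"holds for all large field regions"*; the pure small-field term is no 𝐓′_k(X)) —
a hidden conjunct of the same kind as `Ineq179`'s non-emptiness (refuter pre-price R-ref-g38-2).  The crew's pre-read
S-1 fixed this spelling: a «total count ≤ exp of EVERY sequence's volume sum» field would be uniform in `h`, stronger than print, and is
NOT used.  The PROVED fibrewise weighted form — a sum over histories of `exp` of minus a per-cube constant times the cube
count is controlled fibre by fibre — is `…B16Cor3Ops.sum_major_le_exp_fiber` ∕ `fiber_le_of_card` ∕ `count_absorb`,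
cited there to p. 383 before (1.79).)  The middle clause of the paragraph (*"Similar to the integral with respect to B,
we have to include only the constant with the logarithms in the last line into the integration measure, and we estimate
the quadratic form in B from below by 0."*) is the METHOD of the first sentence and carries no separate inequality.
Carriers as in `Ineq179` (`adm X` the finite admissible family of the region `X`); a `Prop`, nothing asserted.
[cite: Balaban1989LargeFieldII, p.383 l.21-28] -/
structure Txt383 {Dom H : Type*} (adm : Dom → Finset H) (gInt aInt : H → ℕ → ℝ) (volZΩ volZ : H → ℕ → ℝ)
    (k : ℕ) (C' C'' M : ℝ) (d : ℕ) (R : ℕ → ℝ) : Prop where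
  /-- *"All the integrals with respect to the group valued variables in the definition (1.71) are estimated by 1."* -/
  group_le_one : ∀ X, ∀ h ∈ adm X, ∀ j ∈ Finset.Icc 1 k, gInt h j ≤ 1
  /-- *"… we get the factors exp O(1)|Z_j ∩ Ω_j|, where the volume is for the corresponding scale."* -/
  afield_le : ∀ X, ∀ h ∈ adm X, ∀ j ∈ Finset.Icc 1 k, aInt h j ≤ Real.exp (C' * volZΩ h j)
  /-- *"… the summations over the admissible sequences can be replaced by the factors exp O(1)(MR_j)^{−d}|Z_j|."* — per
  sequence: a non-negative weighted sum over the admissible family is at most the weight at SOME member times that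
  member's factors. -/
  admissible_le : ∀ X (F : H → ℝ), (∀ h ∈ adm X, 0 ≤ F h) → (adm X).Nonempty →
    ∃ h₀ ∈ adm X, ∑ h ∈ adm X, F h ≤ F h₀ * ∏ j ∈ Finset.Icc 1 k, Real.exp (C'' * ((M * R j) ^ d)⁻¹ * volZ h₀ j)

/-- SANITY (non-vacuity of the SHAPE): trivial carriers satisfy `Txt383` (`k = 0`, integrals `≡ 1`, one admissible
sequence). [folklore] -/
example : Txt383 (Dom := Unit) (H := Unit) (fun _ => {()}) (fun _ _ => 1) (fun _ _ => 1) (fun _ _ => 0)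
    (fun _ _ => 0) 0 1 1 1 4 (fun _ => 1) where
  group_le_one := by intro X h _ j hj; simp at hj
  afield_le := by intro X h _ j hj; simp at hj
  admissible_le := by
    intro X F _ _
    exact ⟨(), by simp, by simp⟩

end

end Literature.MathematicalPhysics.QuantumFieldTheory.Balaban1983to89.B16Ineq179

namespace Literature.MathematicalPhysics.QuantumFieldTheory.Balaban1983to89.B16Ineq179

noncomputable section

/-! ## §3. (1.79) as the COROLLARY of the estimates before it — the bookkeeping of p. 383's *"Let us summarize now
the results of the above estimates"* (INTERFACE REQUEST NE7b IR-62-1, optional item `ineq179_of_factors`, listed as (c)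
«not typed here» in the v1.5 header above; appended by the NE7b crew, unit `b2b-balaban-t4-ne7b-formalise-leaf-05`
gen 57, on the row owner's word W-ne7bp1-g63-1 «GO — THIS SHAPE») -/

/-- **p. 383 [29], the sentence introducing (1.79)** (render p029), verbatim: *"Let us summarize now the results of the
above estimates. We have obtained the following inequality:"* — the BOOKKEEPING by which the display (1.79) follows from
the estimates stated before it on pp. 380–383, PROVED as real arithmetic over the abstract carriers of `Ineq179` ∕
`Txt383`, every input an explicit hypothesis (nothing of Bałaban's asserted; which operations satisfy the hypotheses is
the consumer's junction, cell item (A1c) of NC-NE7b-α).  INPUTS: `hadm` — the admissible family of every region is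
non-empty (the hidden conjunct of `Ineq179`'s ∃-spelling, displayed); `hsum`, `hterm` — 𝐓′_k(X)1 is dominated by a sum
over the admissible family of non-negative terms (the representation (1.71)∕(1.72): 𝐓′_k(X) as a sum over admissible
sequences of large field domains — a HYPOTHESIS here); `hfac` — THE PENULTIMATE FORM: each term is at most [Π_{j=1}^{k} (group-valued integrals `gInt`) ·
(A_j-integrals `aInt`) · exp(`cV`·M^dR_j^{d+1}d′_j(Z_j))] × [(1.79)'s double product], where exp(`cV`·…) is the constant
*"every large field domain Z_j contributes"* (p. 380, the constants line before (1.76); right member of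
`…B16LargeFieldFactors380.vacuumLine380`),
the Π_i factors are *"the fundamental large field factors"* of pp. 380–381 (`…380.fundamentalFactor_le`) and the Π′
factors are the preparatory ones of p. 383 after (1.78) (`…B16Sect1Kernels.exp_lfFactor_le_exp_neg_p0`) — the cell's
records read this form («one product bound per elementary term, before the history sum», refuter S-ref-g37-1 ∕ owner memo
`g62/A1-PRINT-READ.md` §8); `hg`, `ha` — the integrals are non-negative; `hT : Txt383 …` — the three sentences of p. 383
l. 21–28; `habsA`, `habsE` — the two volume factors those sentences produce, exp(C′|Z_j ∩ Ω_j|) and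
exp(C″(MR_j)^{−d}|Z_j|), are absorbed into the first exponential by p. 380's chain *"O(1) log g_j⁻²|Z_j| ≦ O(1) log
g_j⁻²(MR_j)^d d′_j(Z_j) ≦ O(1)M^dR_j^{d+1}d′_j(Z_j)"* read for them (`C′|Z_j ∩ Ω_j| ≤ cA·M^dR_j^{d+1}·dZ`,
`C″(MR_j)^{−d}|Z_j| ≤ cE·M^dR_j^{d+1}·dZ`; HYPOTHESES — in the repaired `+1` reading of the count, cell D-b02.7, a consumer
instantiates the abstract carrier as `dZ h j = d′_j(Z_j) + 1`; in print's OWN letter `dZ h j = d′_j(Z_j)`, with `C″ > 0`, the hypothesis `habsE`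
FAILS at a one-cube `Z_j` — d′_j = 0 while (MR_j)^{−d}|Z_j| = 1 —, so this corollary reproduces p. 380's chain in
the `+1` reading only: the located slip is print's and on the cell's record, and (1.82) p. 385 is where print pays such per-cube
constants; owner note W-ne7bp1-g63-1 (n1)).  OUTPUT: `Ineq179` with the first exponential's O(1)
`C = cV + cA + cE` — one letter collecting the vacuum-energy, A_j-integral and entropy constants (owner Q-62-fit-1 ∕
refuter v38: «cΛ := O(1)_{p.380} + O(1)_{A_j}»; here the entropy O(1) of `admissible_le` is the third summand because
(1.79) is stated AFTER the history sum).  PROOF: `Txt383.admissible_le` applied to the term weights picks the member `h₀`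
at which the bound is evaluated; `group_le_one`, `afield_le` and the two absorptions are used level by level; products of
exponentials are exponentials of sums (`Real.exp_sum`). [cite: Balaban1989LargeFieldII, p.383 (sentence before (1.79))] -/
theorem ineq179_of_factors {Dom H ι V : Type*} {adm : Dom → Finset H} (hadm : ∀ X, (adm X).Nonempty)
    {T1 : Dom → V → ℝ} {term : Dom → V → H → ℝ} {k : ℕ} {dZ : H → ℕ → ℝ} {comps primed : H → ℕ → Finset ι}
    {dC : H → ℕ → ι → ℝ} {cV cA cE M γ₀ A₁ C' C'' : ℝ} {d : ℕ} {R p0 : ℕ → ℝ}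
    {gInt aInt volZΩ volZ : H → ℕ → ℝ} (hT : Txt383 adm gInt aInt volZΩ volZ k C' C'' M d R)
    (hsum : ∀ X v, T1 X v ≤ ∑ h ∈ adm X, term X v h) (hterm : ∀ X v, ∀ h ∈ adm X, 0 ≤ term X v h)
    (hg : ∀ X, ∀ h ∈ adm X, ∀ j ∈ Finset.Icc 1 k, 0 ≤ gInt h j)
    (ha : ∀ X, ∀ h ∈ adm X, ∀ j ∈ Finset.Icc 1 k, 0 ≤ aInt h j)
    (hfac : ∀ X v, ∀ h ∈ adm X, term X v h ≤
      (∏ j ∈ Finset.Icc 1 k, gInt h j * aInt h j * Real.exp (cV * M ^ d * R j ^ (d + 1) * dZ h j)) *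
        ∏ j ∈ Finset.Icc 1 k,
          ((∏ i ∈ comps h j, Real.exp (-(1 / 2) * γ₀ * A₁ ^ 2 * p0 j ^ 2 * (dC h j i + 1) - 2 * p0 j)) *
            ∏ _i ∈ primed h j, Real.exp (-(p0 j))))
    (habsA : ∀ X, ∀ h ∈ adm X, ∀ j ∈ Finset.Icc 1 k, C' * volZΩ h j ≤ cA * M ^ d * R j ^ (d + 1) * dZ h j)
    (habsE : ∀ X, ∀ h ∈ adm X, ∀ j ∈ Finset.Icc 1 k,
      C'' * ((M * R j) ^ d)⁻¹ * volZ h j ≤ cE * M ^ d * R j ^ (d + 1) * dZ h j) :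
    Ineq179 adm T1 k dZ comps primed dC (cV + cA + cE) M γ₀ A₁ d R p0 := by
  intro X v
  obtain ⟨h₀, hh₀, hle⟩ := hT.admissible_le X (term X v) (hterm X v) (hadm X)
  refine ⟨h₀, hh₀, ?_⟩
  -- the double product of (1.79) at `h₀` is non-negative
  have hLF : 0 ≤ ∏ j ∈ Finset.Icc 1 k,
      ((∏ i ∈ comps h₀ j, Real.exp (-(1 / 2) * γ₀ * A₁ ^ 2 * p0 j ^ 2 * (dC h₀ j i + 1) - 2 * p0 j)) *
        ∏ _i ∈ primed h₀ j, Real.exp (-(p0 j))) :=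
    Finset.prod_nonneg fun j _ =>
      mul_nonneg (Finset.prod_nonneg fun _ _ => (Real.exp_pos _).le)
        (Finset.prod_nonneg fun _ _ => (Real.exp_pos _).le)
  -- level by level: `gInt · aInt · e^{cV…} · e^{C″…} ≤ e^{(cV + cA + cE)…}` (sentences 1–2 of p. 383 + absorptions)
  have hlev : ∀ j ∈ Finset.Icc 1 k,
      gInt h₀ j * aInt h₀ j * Real.exp (cV * M ^ d * R j ^ (d + 1) * dZ h₀ j) *
          Real.exp (C'' * ((M * R j) ^ d)⁻¹ * volZ h₀ j) ≤
        Real.exp ((cV + cA + cE) * M ^ d * R j ^ (d + 1) * dZ h₀ j) := by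
    intro j hj
    have h1 : gInt h₀ j * aInt h₀ j ≤ 1 * Real.exp (C' * volZΩ h₀ j) :=
      mul_le_mul (hT.group_le_one X h₀ hh₀ j hj) (hT.afield_le X h₀ hh₀ j hj) (ha X h₀ hh₀ j hj) zero_le_one
    have h2 := mul_le_mul_of_nonneg_right
      (mul_le_mul_of_nonneg_right h1 (Real.exp_pos (cV * M ^ d * R j ^ (d + 1) * dZ h₀ j)).le)
      (Real.exp_pos (C'' * ((M * R j) ^ d)⁻¹ * volZ h₀ j)).le
    refine h2.trans ?_
    rw [one_mul, ← Real.exp_add, ← Real.exp_add, Real.exp_le_exp]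
    have h3 := habsA X h₀ hh₀ j hj
    have h4 := habsE X h₀ hh₀ j hj
    linarith
  have hlev0 : ∀ j ∈ Finset.Icc 1 k,
      0 ≤ gInt h₀ j * aInt h₀ j * Real.exp (cV * M ^ d * R j ^ (d + 1) * dZ h₀ j) *
          Real.exp (C'' * ((M * R j) ^ d)⁻¹ * volZ h₀ j) := fun j hj =>
    mul_nonneg (mul_nonneg (mul_nonneg (hg X h₀ hh₀ j hj) (ha X h₀ hh₀ j hj)) (Real.exp_pos _).le)
      (Real.exp_pos _).le
  calc T1 X v ≤ ∑ h ∈ adm X, term X v h := hsum X v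
    _ ≤ term X v h₀ * ∏ j ∈ Finset.Icc 1 k, Real.exp (C'' * ((M * R j) ^ d)⁻¹ * volZ h₀ j) := hle
    _ ≤ (∏ j ∈ Finset.Icc 1 k, gInt h₀ j * aInt h₀ j * Real.exp (cV * M ^ d * R j ^ (d + 1) * dZ h₀ j)) *
          (∏ j ∈ Finset.Icc 1 k,
            ((∏ i ∈ comps h₀ j, Real.exp (-(1 / 2) * γ₀ * A₁ ^ 2 * p0 j ^ 2 * (dC h₀ j i + 1) - 2 * p0 j)) *
              ∏ _i ∈ primed h₀ j, Real.exp (-(p0 j)))) *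
          ∏ j ∈ Finset.Icc 1 k, Real.exp (C'' * ((M * R j) ^ d)⁻¹ * volZ h₀ j) :=
        mul_le_mul_of_nonneg_right (hfac X v h₀ hh₀) (Finset.prod_nonneg fun _ _ => (Real.exp_pos _).le)
    _ = (∏ j ∈ Finset.Icc 1 k, gInt h₀ j * aInt h₀ j * Real.exp (cV * M ^ d * R j ^ (d + 1) * dZ h₀ j) *
            Real.exp (C'' * ((M * R j) ^ d)⁻¹ * volZ h₀ j)) *
          ∏ j ∈ Finset.Icc 1 k,
            ((∏ i ∈ comps h₀ j, Real.exp (-(1 / 2) * γ₀ * A₁ ^ 2 * p0 j ^ 2 * (dC h₀ j i + 1) - 2 * p0 j)) *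
              ∏ _i ∈ primed h₀ j, Real.exp (-(p0 j))) := by
        rw [mul_right_comm, ← Finset.prod_mul_distrib]
    _ ≤ (∏ j ∈ Finset.Icc 1 k, Real.exp ((cV + cA + cE) * M ^ d * R j ^ (d + 1) * dZ h₀ j)) *
          ∏ j ∈ Finset.Icc 1 k,
            ((∏ i ∈ comps h₀ j, Real.exp (-(1 / 2) * γ₀ * A₁ ^ 2 * p0 j ^ 2 * (dC h₀ j i + 1) - 2 * p0 j)) *
              ∏ _i ∈ primed h₀ j, Real.exp (-(p0 j))) :=
        mul_le_mul_of_nonneg_right (Finset.prod_le_prod hlev0 hlev) hLF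
    _ = rhs179 k dZ comps primed dC (cV + cA + cE) M γ₀ A₁ d R p0 h₀ := by
        rw [rhs179, Real.exp_sum]

/-- SANITY (the hypotheses of `ineq179_of_factors` are jointly inhabited by non-degenerate data, and the theorem then
yields the display — NOT an instance of the paper's claim): one region, ONE admissible history, `k = 1`, one component
(`d′ = 0`) and one primed component at step 1, group integral `1`, A-integral `e^{C′·|Z ∩ Ω|}` with `C′ = |Z ∩ Ω| = 1`,
`|Z| = 1`, vacuum constant `cV = 1`, absorptions with `cA = cE = 1` (`M = R₁ = d′ + 1 = 1`), the term EQUAL to its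
factor bound; `Ineq179` follows with `C = 3`. [folklore] -/
example : Ineq179 (Dom := Unit) (H := Unit) (ι := Unit) (V := Unit) (fun _ => {()})
    (fun _ _ => (1 * Real.exp (1 * 1) * Real.exp (1 * 1 ^ 4 * 1 ^ (4 + 1) * 1)) *
      (Real.exp (-(1 / 2) * 1 * 1 ^ 2 * 1 ^ 2 * (0 + 1) - 2 * 1) * Real.exp (-(1 : ℝ))))
    1 (fun _ _ => 1) (fun _ _ => {()}) (fun _ _ => {()}) (fun _ _ _ => 0) (1 + 1 + 1) 1 1 1 4 (fun _ => 1)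
    (fun _ => 1) := by
  refine ineq179_of_factors (gInt := fun _ _ => 1) (aInt := fun _ _ => Real.exp (1 * 1)) (volZΩ := fun _ _ => 1)
    (volZ := fun _ _ => 1) (C' := 1) (C'' := 1)
    (term := fun _ _ _ => (1 * Real.exp (1 * 1) * Real.exp (1 * 1 ^ 4 * 1 ^ (4 + 1) * 1)) *
      (Real.exp (-(1 / 2) * 1 * 1 ^ 2 * 1 ^ 2 * (0 + 1) - 2 * 1) * Real.exp (-(1 : ℝ))))
    (fun _ => by simp) ⟨?_, ?_, ?_⟩ ?_ ?_ ?_ ?_ ?_ ?_ ?_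
  · intro X h _ j _; simp
  · intro X h _ j _; simp
  · intro X F hF _
    refine ⟨(), by simp, ?_⟩
    have h0 : 0 ≤ F () := hF () (by simp)
    rw [Finset.sum_singleton, Finset.Icc_self, Finset.prod_singleton]
    exact le_mul_of_one_le_right h0 (Real.one_le_exp (by norm_num))
  · intro X v; simp
  · intro X v h _; positivity
  · intro X h _ j _; norm_num
  · intro X h _ j _; positivity
  · intro X v h _; simp
  · intro X h _ j _; norm_num
  · intro X h _ j _; norm_num

end

end Literature.MathematicalPhysics.QuantumFieldTheory.Balaban1983to89.B16Ineq179
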